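import Summits.QuantumFields.YangMills.Theorems.ConvexGribovBodyNonSimplyConnectedLatticeGapStubCorrPullbackCover
import Summits.QuantumFields.YangMills.Theorems.ConvexGribovBodyNonSimplyConnectedLatticeGapStubBoxInfluenceOfCover
import HarnessLib

/-!
# Crux `NonSimplyConnectedLatticeGap` (stmt-QuantumFields-16405), route `ConvexGribovBody`,
# line `Sketch` (v9) — stub `stub_meanBoxInfluence_of_cover` (COVER: the averaged leaf descends
# along a cover, exactly)

For a continuous SURJECTIVE homomorphism `π : H →* G` of compact metrisable groups (the case in
point is the universal cover `SU(2) → SO(3) = SU(2)/{±1}`), a continuous matrix representation `ρ`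
of `G`, a coupling `β`, a local observable `A` of `G`-configurations on `ℤ⁴`, a cube `Λ_L` and a
torus of side `2S+1`, the AVERAGED cube influence

`∫ |γ^{ρ}_{Λ_L}(A | Ũ) − μ^{ρ}_S(A ∘ torusLift)| dμ^{ρ}_S(U)`     (`Ũ = torusLift (2S+1) U`)

of the `(G, ρ)` theory EQUALS the same quantity of the covering theory `(H, ρ ∘ π)` evaluated on
the pulled-back observable `A ∘ Φ`, `Φ V = π ∘ V`. Three transports along `Φ`:

* the torus means agree, `μ^{ρ∘π}_S((A ∘ torusLift) ∘ Φ) = μ^{ρ}_S(A ∘ torusLift)`, because the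
  periodic lift commutes with `Φ` (`π ∘ Ũ = (π ∘ U)~`, definitionally) and the torus Wilson state
  of the covering theory pushes forward to the `(G, ρ)` state (K1,
  `integral_wilsonMeasure_comp_of_surjective`);
* the kernel means agree, `γ^{ρ∘π}_Λ(A ∘ Φ | ζ) = γ^{ρ}_Λ(A | π ∘ ζ)` (KC,
  `integral_ymSpecification_comp_of_surjective`);
* hence the `(H, ρ ∘ π)` integrand is the pull-back `F₀ ∘ Φ` of the (measurable) `(G, ρ)` integrand
  `F₀(U) = |γ^{ρ}_{Λ_L}(A | Ũ) − μ^{ρ}_S(A ∘ torusLift)|`, and K1 once more gives the claim.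

For `G = SO(3)`: the averaged weak-mixing leaf for `SO(3)` IS the leaf of the adjoint-action
`SU(2)` theory on `±1`-blind observables, flux sectors included.
-/

set_option autoImplicit false

noncomputable section

open MeasureTheory

namespace Summit.QuantumFields.YangMills.Theorems.NonSimplyConnectedLatticeGap

open Literature.MathematicalPhysics.QuantumLattice
open Literature.MathematicalPhysics.QuantumFieldTheory (wilsonMeasure GaugeConfig
  isSpecification_ymSpecification_of_t2Space measurable_torusLift)

/-- **STUB COVER — the averaged leaf descends along a cover, exactly**: for a continuous surjective
homomorphism `π : H →* G` of compact metrisable groups, a continuous representation `ρ` of `G`,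
every `β`, every local gauge-invariant observable `A` of `G`-configurations on `ℤ⁴`, every cube
size `L` and torus parameter `S`, the averaged cube influence
`∫ |γ^{ρ}_{Λ_L}(A | Ũ) − μ^{ρ}_S(A ∘ torusLift)| dμ^{ρ}_S(U)` of `(G, ρ, A)` equals that of
`(H, ρ ∘ π, A ∘ (π ∘ ·))`. The torus states push forward (K1
`map_wilsonMeasure_comp_of_surjective` / `integral_wilsonMeasure_comp_of_surjective`), the kernels
push forward (KC `integral_ymSpecification_comp_of_surjective`), and `π ∘ Ũ = (π ∘ U)~`.
[folklore] -/
theorem stub_meanBoxInfluence_of_cover : ∀ (G : Type) [Group G] [TopologicalSpace G] [IsTopologicalGroup G] [CompactSpace G] [MeasurableSpace G] [BorelSpace G] [SecondCountableTopology G] [T2Space G] (H : Type) [Group H] [TopologicalSpace H] [IsTopologicalGroup H] [CompactSpace H] [MeasurableSpace H] [BorelSpace H] [SecondCountableTopology H] [T2Space H] (π : H →* G), Continuous π → Function.Surjective π → ∀ (N : ℕ) (ρ : G →* Matrix (Fin N) (Fin N) ℂ), Continuous ρ → ∀ (β : ℝ) (A : Literature.MathematicalPhysics.QuantumLattice.LocalGaugeObservable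 4 G) (L S : ℕ), ∫ V, |(∫ U, A.F U ∂(Literature.MathematicalPhysics.QuantumLattice.ymSpecification ρ β ((Fintype.piFinset fun _ : Fin 4 => Finset.Icc (-((L : ℕ) : ℤ)) ((L : ℕ) : ℤ)) ×ˢ (Finset.univ : Finset (Fin 4))) (Literature.MathematicalPhysics.QuantumLattice.torusLift (2 * S + 1) V))) - ∫ W, A.F (Literature.MathematicalPhysics.QuantumLattice.torusLift (2 * S + 1) W) ∂(Literature.MathematicalPhysics.QuantumFieldTheory.wilsonMeasure (d := 4) (L := 2 * S + 1) ρ β)| ∂(Literature.MathematicalPhysics.QuantumFieldTheory.wilsonMeasure (d := 4) (L := 2 * S + 1) ρ β) = ∫ V, |(∫ U, A.F (fun e => π (U e)) ∂(Literature.MathematicalPhysics.QuantumLattice.ymSpecification (ρ.comp π) β ((Fintype.piFinset fun _ : Fin 4 => Finset.Icc (-((L : ℕ) : ℤ)) ((L : ℕ) : ℤ)) ×ˢ (Finset.univ : Finset (Fin 4))) (Literature.MathematicalPhysics.QuantumLattice.torusLift (2 * S + 1) V))) - ∫ W, A.F (fun e => π (Literature.MathematicalPhysics.QuantumLattice.torusLift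 (2 * S + 1) W e)) ∂(Literature.MathematicalPhysics.QuantumFieldTheory.wilsonMeasure (d := 4) (L := 2 * S + 1) (ρ.comp π) β)| ∂(Literature.MathematicalPhysics.QuantumFieldTheory.wilsonMeasure (d := 4) (L := 2 * S + 1) (ρ.comp π) β) := by
  intro G _ _ _ _ _ _ _ _ H _ _ _ _ _ _ _ _ π hπ hsurj N ρ hρ β A L S
  -- the cube `Λ_L` and the torus mean `c` of the `(G, ρ)` theory
  set Λ : Finset (ZdEdge 4) := (Fintype.piFinset fun _ : Fin 4 => Finset.Icc (-((L : ℕ) : ℤ))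
    ((L : ℕ) : ℤ)) ×ˢ (Finset.univ : Finset (Fin 4))
  set c : ℝ := ∫ W, A.F (torusLift (2 * S + 1) W) ∂(wilsonMeasure (d := 4) (L := 2 * S + 1) ρ β)
  -- measurability: the kernel mean `η ↦ γ_Λ(A | η)`, the periodic lift, the `(G, ρ)` integrand `F₀`
  have hγ := isSpecification_ymSpecification_of_t2Space (d := 4) ρ hρ β
  have hg : Measurable fun η : LGConfig 4 G => ∫ U, A.F U ∂(ymSpecification ρ β Λ η) :=
    Literature.Probability.LatticeModels.DobrushinShlosman.measurable_windowAvg' hγ Λ A.measurable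
  have hT : Measurable (torusLift (d := 4) (G := G) (2 * S + 1)) := measurable_torusLift _
  have hF₀ : Measurable fun V : GaugeConfig 4 (2 * S + 1) G =>
      |(∫ U, A.F U ∂(ymSpecification ρ β Λ (torusLift (2 * S + 1) V))) - c| :=
    continuous_abs.measurable.comp ((hg.comp hT).sub_const c)
  -- (a) the torus means agree: `π ∘ (torusLift W) = torusLift (π ∘ W)` definitionally, then K1
  have hc : ∫ W, A.F (fun e => π (torusLift (2 * S + 1) W e))
      ∂(wilsonMeasure (d := 4) (L := 2 * S + 1) (ρ.comp π) β) = c :=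
    integral_wilsonMeasure_comp_of_surjective (d := 4) (L := 2 * S + 1) π hπ hsurj ρ hρ β
      (A.measurable.comp hT)
  -- (b) the kernel means agree (KC)
  have hker : ∀ ζ : LGConfig 4 H,
      ∫ U, A.F (fun e => π (U e)) ∂(ymSpecification (ρ.comp π) β Λ ζ) =
        ∫ U, A.F U ∂(ymSpecification ρ β Λ (fun e => π (ζ e))) := fun ζ =>
    integral_ymSpecification_comp_of_surjective π hπ hsurj ρ hρ β Λ ζ A.measurable
  -- (c) the `(H, ρ ∘ π)` integrand is `F₀ (π ∘ V)`: change variables along K1 once more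
  rw [← integral_wilsonMeasure_comp_of_surjective (d := 4) (L := 2 * S + 1) π hπ hsurj ρ hρ β hF₀]
  refine integral_congr_ae (ae_of_all _ fun V => ?_)
  dsimp only
  rw [hker, hc]
  rfl

end Summit.QuantumFields.YangMills.Theorems.NonSimplyConnectedLatticeGap

end
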